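import Summits.QuantumFields.BalabanUV.T4Continuum.Support.ShellMeasureWilsonRealizedSUNWords
import Summits.QuantumFields.BalabanUV.T4Continuum.Support.ShellMeasureScalingSUN
import Summits.QuantumFields.BalabanUV.T4Continuum.Support.ShellMeasureAxialReach
import Literature.MathematicalPhysics.QuantumFieldTheory.Balaban1983to89.MatrixLog

/-!
# `T4Continuum.ShellMeasureAxialReachSUN` — (LR)₀ FOR `G = SU(N)`, configuration level: a unitary of determinant one
# close to `1` in the operator norm lies in the exponential Hilbert–Schmidt window of the `SU(N)` chart, so a
# configuration TRIVIAL ON THE AXIAL COMB of a box whose box plaquettes are small has every box bond inside ONE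
# image window `expWindowSU 1 S` — the reach lemma that makes the bond window of the realized (M1)₀ for `SU(N)`
# (`ShellMeasureWilsonRealizedSUN`, row S34) a consequence of plaquette smallness after the tree gauge
# (cell `pub-balaban`, sub-cell `t4`, spine estimate NE7c (node U5b); ROUND-2 crew `t4-ne7c-formalise-*`, seat
# `b2b-balaban-t4-ne7c-formalise-leaf-10` (gen 7); OFFERED leaf «(LR)₀ FOR SU(N): THE AXIAL REACH INTO THE EXPONENTIAL
# HS-WINDOW» (journal `CLAIMS.log` l.12496; c5 orbit of rows S3∕S30∕S31∕S34 of `t4/b2b-balaban-t4-ne7c-p1/LEAVES-NE7c-P1.md`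
# — `SU(2)` is the row's certified instance); the `SU(N)` counterpart of §3 of `ShellMeasureAxialReach` (lineage
# t4-ne7c-p1 gen 26, p207245), whose §1–§2 (the comb reach `dist1 ≤ (d−1)·n·a`, ANY gauge group) are consumed BY NAME;
# ADDITIVE — imports `ShellMeasureWilsonRealizedSUNWords` (the entry sums of the chart generator, p216947),
# `ShellMeasureScalingSUN` (`expBallSU`, `expWindowSU`, `windowSU`), `ShellMeasureAxialReach` and the tree's
# `MatrixLog` ([Balaban1985Averaging] (23)–(25): `exists_isHermitian_exp_eq`) only; 0 `def`, 0 sorry, 0 citations)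

HONEST FRAMING.  Finite four-torus programme, rung (B)+1 only — NOT infinite volume, NOT a mass gap, NOT the Clay
problem, NOT summit progress; (B), `BetaPertHyp`, (B^μ) are not mentioned because nothing here consumes them.  The
cell wall of NE7c — (M1) `T4ShellMeasure.SlotAntiConcentration` FOR BAŁABAN'S INDUCTIVELY DEFINED EFFECTIVE MEASURES —
is NOT PRINTED in [Balaban 1983–89] (GAPS G-ne7cp1-1), asserted by nobody, and NOT moved by this file; NOTHING in the
countdown moves (spine PROVED 0/9); (M1)₀ realized ≠ NE7c (trigger c3); `SU(2)` stays the certified instance (c5).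
[folklore] classical matrix analysis + kernel bookkeeping over tree theorems BY NAME.  HONEST DEPENDENCY (cell):
continuum YM on T⁴ ⇐ BetaPertH ∧ nine spine estimates (0/9 proved); BetaPertH ⇐ (D1) ∧ (D4) ∧ CAP+tail; G-an2-4 gates
asym, D1 and NE2/3/4.

THE POINTS.
* §0 **`‖X‖_HS ≤ √N·‖X‖_op` ON `M_N(ℂ)`** (`sum_sq_entry_le_card_mul_sq`: every column of `X` has Euclidean norm
  `≤ ‖X‖_op`), the converse companion of `ShellMeasureWilsonRealizedSUNWords.l2_opNorm_le_sqrt_sum_sq`; with the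
  chart isometry (`sum_sq_entry_genSU`): `norm_le_sqrt_card_mul_norm_genSU : ‖v‖ ≤ √N·‖genSU v‖_op`.
* §1 **THE `SU(N)` LOGARITHM INTO THE CHART** (`exists_expPtSU_eq_of_dist1`): `U : SU(N)` with `N·dist1 U < 4` is
  `U = expPtSU v` for a chart point `‖v‖ ≤ √N·(π/2)·dist1 U`.  From the tree's `MatrixLog.exists_isHermitian_exp_eq`
  (`U = e^{iA}`, `A` Hermitian, `‖A‖_op ≤ (π/2)·|U − 1|`) and Liouville's formula `det e^{iA} = e^{i tr A}`
  (`Literature.Analysis.Matrix.det_exp_eq_exp_trace`): `det U = 1` puts `tr A ∈ 2πℤ`, and `|tr A| ≤ N‖A‖_op < 2π` forces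
  `tr A = 0`, so `iA ∈ 𝔰𝔲(N)` (`trace_eq_zero_of_det_exp_eq_one`).
* §2 **THE REACH**: `dist1 U ≤ r`, `N·r < 4`, `√N·(π/2)·r ≤ S` ⟹ `U ∈ expBallSU S = expWindowSU 1 S`
  (`mem_expBallSU_of_dist1_le`, `mem_expWindowSU_one_of_dist1_le`); with the generic comb chain of
  `ShellMeasureAxialReach` (§1–§2 there, any gauge group): a configuration equal to `1` on `combBonds lo hi` whose box
  plaquettes are `a`-small has every box bond in `expWindowSU 1 S` once `√N·(π/2)·((d−1)·n·a) ≤ S` and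
  `N·((d−1)·n·a) < 4` (`mem_expWindowSU_of_comb`), hence the block-side window weight of the `SU(N)` road takes the
  value `1` at the restriction of the configuration to any `Λ ⊆ boxBonds lo hi` (`windowSU_eq_one_of_comb`,
  `windowSU_fixTo_comb_eq_one` for the tree-gauge substitution `U[comb := 1]`) — the `SU(N)` form of (LR)₀.

WHAT THIS DOES NOT DO.  No measure statement; the gauge-invariant level-0 face for `SU(N)` (S1's `giF` form through
the reach) is a separate file; (MR)₀, anything at `j ≥ 1`; NE7c NOT proved; 0/9 spine.
-/

noncomputable section

open NormedSpace Set Function MeasureTheory Metric Complex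

namespace Summit.QuantumFields.BalabanUV.T4Continuum.ShellMeasureAxialReachSUN

open scoped ENNReal Matrix.Norms.L2Operator
open Literature.MathematicalPhysics.QuantumFieldTheory.Balaban1983to89
open T4AdjointCovarianceUnitary (lieSU expSU mem_lieSU_iff coe_expSU)
open ShellMeasureExpChartSUN
open ShellMeasureScalingSUN (expBallSU expWindowSU windowSU windowSU_eq_indicator)
open ShellMeasureWilsonRealizedSUN (sum_sq_entry_genSU)
open ShellMeasureWilsonBlock (matrixTrace matrixTrace_τ matrixTrace_N)
open T4AxialGaugeSmallField (boxPlaqs boxBonds)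
open T4AxialGaugeFixing (combBonds)
open T4TreeGaugeFixing (fixTo)

/-! ## §0 The Hilbert–Schmidt norm is at most `√N` times the operator norm -/

section HS

variable {m : Type*} [Fintype m] [DecidableEq m]

/-- one column: `Σ_i ‖A i j‖² ≤ ‖A‖²_op` (the column is `A e_j`, `‖e_j‖ = 1`). [folklore] -/
theorem sum_sq_entry_col_le (A : Matrix m m ℂ) (j : m) : ∑ i, ‖A i j‖ ^ 2 ≤ ‖A‖ ^ 2 := by
  have hcol : ∀ i, (Matrix.toEuclideanCLM (n := m) (𝕜 := ℂ) A (EuclideanSpace.single j (1 : ℂ))) i = A i j := by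
    intro i
    rw [show (Matrix.toEuclideanCLM (n := m) (𝕜 := ℂ) A (EuclideanSpace.single j (1 : ℂ))) i =
      (A.mulVec (WithLp.ofLp (EuclideanSpace.single j (1 : ℂ)))) i from rfl]
    rw [PiLp.ofLp_single, Matrix.mulVec_single_one]
    rfl
  have h1 : ∑ i, ‖A i j‖ ^ 2 = ‖Matrix.toEuclideanCLM (n := m) (𝕜 := ℂ) A (EuclideanSpace.single j (1 : ℂ))‖ ^ 2 := by
    rw [EuclideanSpace.norm_sq_eq]
    exact Finset.sum_congr rfl fun i _ => by rw [hcol i]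
  rw [h1]
  have h2 : ‖Matrix.toEuclideanCLM (n := m) (𝕜 := ℂ) A (EuclideanSpace.single j (1 : ℂ))‖ ≤ ‖A‖ := by
    calc _ ≤ ‖Matrix.toEuclideanCLM (n := m) (𝕜 := ℂ) A‖ * ‖EuclideanSpace.single j (1 : ℂ)‖ :=
          ContinuousLinearMap.le_opNorm _ _
      _ = ‖A‖ := by rw [PiLp.norm_single, norm_one, mul_one, Matrix.l2_opNorm_toEuclideanCLM]
  exact pow_le_pow_left₀ (norm_nonneg _) h2 2

/-- **`‖X‖²_HS ≤ N·‖X‖²_op`**: the sum of the squared entries is at most `card m` times the squared operator norm.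
[folklore] -/
theorem sum_sq_entry_le_card_mul_sq (A : Matrix m m ℂ) : ∑ i, ∑ j, ‖A i j‖ ^ 2 ≤ Fintype.card m * ‖A‖ ^ 2 := by
  rw [Finset.sum_comm]
  calc ∑ j, ∑ i, ‖A i j‖ ^ 2 ≤ ∑ _j : m, ‖A‖ ^ 2 := Finset.sum_le_sum fun j _ => sum_sq_entry_col_le A j
    _ = Fintype.card m * ‖A‖ ^ 2 := by rw [Finset.sum_const, Finset.card_univ, nsmul_eq_mul]

end HS

variable {N : ℕ} [NeZero N]

omit [NeZero N] in
/-- **THE CHART POINT IS AT MOST `√N` TIMES THE OPERATOR NORM OF ITS GENERATOR**: `‖v‖ ≤ √N·‖genSU v‖_op`.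
[folklore] -/
theorem norm_le_sqrt_card_mul_norm_genSU (v : ChartSU N) : ‖v‖ ≤ Real.sqrt N * ‖genSU v‖ := by
  have h := sum_sq_entry_le_card_mul_sq (genSU v)
  rw [sum_sq_entry_genSU, Fintype.card_fin] at h
  have h2 : ‖v‖ ^ 2 ≤ (Real.sqrt N * ‖genSU v‖) ^ 2 := by
    rw [mul_pow, Real.sq_sqrt (Nat.cast_nonneg N)]
    exact h
  exact (pow_le_pow_iff_left₀ (norm_nonneg _) (by positivity) two_ne_zero).mp h2

/-! ## §1 The `SU(N)` logarithm lands in the chart: trace-freeness from `det = 1` -/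

/-- **`det e^{iA} = 1` WITH `A` HERMITIAN AND `N·‖A‖_op < 2π` FORCES `tr A = 0`.**  Liouville `det e^{iA} = e^{i tr A}`
(`Literature.Analysis.Matrix.det_exp_eq_exp_trace`) puts `i·tr A ∈ 2πiℤ`; `tr A` is real with `|tr A| ≤ N‖A‖_op`
(`ShellMeasureWilsonBlock.matrixTrace`), so the integer is `0`. [folklore] -/
theorem trace_eq_zero_of_det_exp_eq_one {A : Matrix (Fin N) (Fin N) ℂ} (hA : A.IsHermitian)
    (hsmall : (N : ℝ) * ‖A‖ < 2 * Real.pi) (hdet : (NormedSpace.exp (I • A)).det = 1) : A.trace = 0 := by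
  rw [Literature.Analysis.Matrix.det_exp_eq_exp_trace, Matrix.trace_smul, smul_eq_mul,
    ← congr_fun Complex.exp_eq_exp_ℂ (I * A.trace)] at hdet
  obtain ⟨k, hk⟩ := Complex.exp_eq_one_iff.1 hdet
  -- the trace is real
  have hre : ((A.trace.re : ℝ) : ℂ) = A.trace := by
    have hstar : star A.trace = A.trace := by
      rw [← Matrix.trace_conjTranspose, hA.eq]
    exact Complex.ext rfl (by
      have him := congrArg Complex.im hstar
      rw [Complex.star_def, Complex.conj_im] at him
      simp only [Complex.ofReal_im]
      linarith)
  -- its size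
  have habs : |A.trace.re| ≤ (N : ℝ) * ‖A‖ := by
    have h := (matrixTrace (n := Fin N)).abs_le A
    rwa [matrixTrace_τ, matrixTrace_N, Fintype.card_fin] at h
  -- the integer `k`: `|k|·2π = |tr A| < 2π`
  have hk' : (A.trace.re : ℝ) = k * (2 * Real.pi) := by
    have h := congrArg Complex.im hk
    rw [Complex.mul_im, Complex.I_re, Complex.I_im, zero_mul, one_mul, zero_add] at h
    have h2 : ((k : ℂ) * (2 * Real.pi * I)).im = k * (2 * Real.pi) := by
      simp [Complex.mul_im]
    rw [h2] at h
    rw [← h, ← hre, Complex.ofReal_re]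
  have hk0 : k = 0 := by
    have h0 : |(k : ℝ) * (2 * Real.pi)| < 2 * Real.pi := by rw [← hk']; exact habs.trans_lt hsmall
    rw [abs_mul, abs_of_pos Real.two_pi_pos] at h0
    have h2 : |(k : ℝ)| < 1 := by
      by_contra hc
      push Not at hc
      have := mul_le_mul_of_nonneg_right hc Real.two_pi_pos.le
      linarith
    have h3 : |k| < 1 := by exact_mod_cast h2
    exact Int.abs_lt_one_iff.mp h3
  rw [← hre, hk', hk0]
  simp

/-- **THE `SU(N)` LOGARITHM INTO THE CHART.**  `U : SU(N)` with `N·dist1 U < 4` is a chart point: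
`U = expPtSU v` with `‖v‖ ≤ √N·(π/2)·dist1 U` (`‖·‖` the Hilbert–Schmidt norm of the chart, `dist1` the operator-norm
distance to `1`).  From `MatrixLog.exists_isHermitian_exp_eq` ([Balaban1985Averaging] (23)–(25) for matrices, in the
tree): `U = e^{iA}`, `A` Hermitian, `‖A‖_op ≤ (π/2)·dist1 U`; then `N‖A‖_op < 2π`, so `tr A = 0`
(`trace_eq_zero_of_det_exp_eq_one`) and `iA ∈ 𝔰𝔲(N)`; `v := coordSU⁻¹(iA)`, `‖v‖ = ‖iA‖_HS ≤ √N‖A‖_op` (§0). [folklore] -/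
theorem exists_expPtSU_eq_of_dist1 (U : SUN N) (hU : (N : ℝ) * dist1 U < 4) :
    ∃ v : ChartSU N, expPtSU v = U ∧ ‖v‖ ≤ Real.sqrt N * (Real.pi / 2 * dist1 U) := by
  obtain ⟨A, hA, -, hexp, -, hAle⟩ := MatrixLog.exists_isHermitian_exp_eq (U := (U : Matrix (Fin N) (Fin N) ℂ)) U.2.1
  have hdist : UnitaryModel.opDist1 (U : Matrix (Fin N) (Fin N) ℂ) = dist1 U := rfl
  rw [hdist] at hAle
  -- `N‖A‖ < 2π`
  have hN0 : (0 : ℝ) ≤ N := Nat.cast_nonneg N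
  have hsmall : (N : ℝ) * ‖A‖ < 2 * Real.pi := by
    calc (N : ℝ) * ‖A‖ ≤ N * (Real.pi / 2 * dist1 U) := mul_le_mul_of_nonneg_left hAle hN0
      _ = Real.pi / 2 * (N * dist1 U) := by ring
      _ < Real.pi / 2 * 4 := mul_lt_mul_of_pos_left hU (by positivity)
      _ = 2 * Real.pi := by ring
  -- `det U = 1` ⟹ `tr A = 0`
  have hdet : (NormedSpace.exp (I • A)).det = 1 := by rw [hexp]; exact U.2.2
  have htr : A.trace = 0 := trace_eq_zero_of_det_exp_eq_one hA hsmall hdet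
  -- `iA ∈ 𝔰𝔲(N)`
  have hmem : I • A ∈ lieSU (Fin N) := by
    rw [mem_lieSU_iff]
    refine ⟨?_, by rw [Matrix.trace_smul, htr, smul_zero]⟩
    rw [star_smul, Matrix.star_eq_conjTranspose, hA.eq, Complex.star_def, Complex.conj_I, neg_smul]
  refine ⟨coordSU.symm ⟨I • A, hmem⟩, ?_, ?_⟩
  · apply Subtype.ext
    show ((expSU (coordSU (coordSU.symm ⟨I • A, hmem⟩)) : SUN N) : Matrix (Fin N) (Fin N) ℂ) = U
    rw [LinearIsometryEquiv.apply_symm_apply, coe_expSU]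
    exact hexp
  · have h1 : ‖coordSU.symm ⟨I • A, hmem⟩‖ ≤ Real.sqrt N * ‖genSU (coordSU.symm ⟨I • A, hmem⟩)‖ :=
      norm_le_sqrt_card_mul_norm_genSU _
    have h2 : genSU (coordSU.symm ⟨I • A, hmem⟩) = I • A := by
      unfold genSU
      rw [LinearIsometryEquiv.apply_symm_apply]
    rw [h2, norm_smul, Complex.norm_I, one_mul] at h1
    exact h1.trans (mul_le_mul_of_nonneg_left hAle (Real.sqrt_nonneg _))

/-! ## §2 The reach: small `dist1` ⟹ inside the exponential window; comb-trivial + plaquette-small ⟹ every box bond -/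

/-- **SMALL `dist1` PUTS A UNITARY OF DETERMINANT ONE IN THE EXPONENTIAL HS-BALL**: `dist1 U ≤ r`, `N·r < 4`,
`√N·(π/2)·r ≤ S` ⟹ `U ∈ expBallSU S`. [folklore] -/
theorem mem_expBallSU_of_dist1_le {U : SUN N} {r S : ℝ} (hU : dist1 U ≤ r) (hr : (N : ℝ) * r < 4)
    (hS : Real.sqrt N * (Real.pi / 2 * r) ≤ S) : U ∈ expBallSU S := by
  have hN0 : (0 : ℝ) ≤ N := Nat.cast_nonneg N
  obtain ⟨v, hv, hvle⟩ := exists_expPtSU_eq_of_dist1 U ((mul_le_mul_of_nonneg_left hU hN0).trans_lt hr)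
  refine ⟨v, mem_closedBall_zero_iff.2 (hvle.trans ((mul_le_mul_of_nonneg_left
    (mul_le_mul_of_nonneg_left hU (by positivity)) (Real.sqrt_nonneg _)).trans hS)), hv⟩

/-- … equivalently in the image window about `1`: `U ∈ expWindowSU 1 S`. [folklore] -/
theorem mem_expWindowSU_one_of_dist1_le {U : SUN N} {r S : ℝ} (hU : dist1 U ≤ r) (hr : (N : ℝ) * r < 4)
    (hS : Real.sqrt N * (Real.pi / 2 * r) ≤ S) : U ∈ expWindowSU 1 S :=
  ⟨U, mem_expBallSU_of_dist1_le hU hr hS, one_mul U⟩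

variable {P : Params} {j : ℕ}

/-- **THE REACH FOR `SU(N)`**: comb-trivial on `combBonds lo hi` + box plaquettes `a`-small (`S₀ ⊇ boxPlaqs lo hi`,
`0 ≤ a`, `hi ≤ lo + n`) + `N·((d−1)·n·a) < 4` + `√N·(π/2)·((d−1)·n·a) ≤ S` put every box bond OF THE CONFIGURATION
ITSELF in `expWindowSU 1 S` (the comb estimate `dist1 ≤ (d−1)·n·a` is `ShellMeasureAxialReach.dist1_le_of_comb_of_mem_boxBonds`,
any gauge group). [folklore] -/
theorem mem_expWindowSU_of_comb (U : GaugeField P j (SUN N)) {lo hi : Fin P.d → ℤ} {a S : ℝ}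
    {S₀ : Set (Plaq P j)} {n : ℕ} (hS₀ : boxPlaqs lo hi ⊆ S₀) (hUa : PlaqSmallOn S₀ a U) (ha : 0 ≤ a)
    (hn : ∀ κ, hi κ ≤ lo κ + n) (hU : ∀ b ∈ (combBonds lo hi : Finset (PBond P j)), U b = 1)
    (hN4 : (N : ℝ) * (((P.d - 1 : ℕ) : ℝ) * n * a) < 4)
    (hrad : Real.sqrt N * (Real.pi / 2 * (((P.d - 1 : ℕ) : ℝ) * n * a)) ≤ S) {b : PBond P j}
    (hb : b ∈ boxBonds lo hi) : U b ∈ expWindowSU 1 S :=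
  mem_expWindowSU_one_of_dist1_le
    (ShellMeasureAxialReach.dist1_le_of_comb_of_mem_boxBonds U hS₀ hUa ha hn hU hb) hN4 hrad

omit [NeZero N] in
/-- the block-side window weight takes the value `1` at a block configuration all of whose bonds are in their
windows. [folklore] -/
theorem windowSU_eq_one_of_mem (Λ : Finset (PBond P j)) (u₀ : GaugeField P j (SUN N)) (S : ℝ)
    {y : ↥Λ → SUN N} (hy : ∀ b : ↥Λ, y b ∈ expWindowSU (u₀ b) S) : windowSU Λ u₀ S y = 1 := by
  have hmem : y ∈ Set.pi univ fun b : ↥Λ => expWindowSU (u₀ b) S := fun b _ => hy b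
  rw [windowSU_eq_indicator, indicator_of_mem hmem, Pi.one_apply]

/-- **DENSITY FORM**: under the hypotheses of `mem_expWindowSU_of_comb` the window weight of the `SU(N)` road about the
trivial configuration over any `Λ ⊆ boxBonds lo hi` takes the value `1` AT THE CONFIGURATION ITSELF. [folklore] -/
theorem windowSU_eq_one_of_comb (U : GaugeField P j (SUN N)) {lo hi : Fin P.d → ℤ} {a S : ℝ}
    {S₀ : Set (Plaq P j)} {n : ℕ} (hS₀ : boxPlaqs lo hi ⊆ S₀) (hUa : PlaqSmallOn S₀ a U) (ha : 0 ≤ a)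
    (hn : ∀ κ, hi κ ≤ lo κ + n) (hU : ∀ b ∈ (combBonds lo hi : Finset (PBond P j)), U b = 1)
    (hN4 : (N : ℝ) * (((P.d - 1 : ℕ) : ℝ) * n * a) < 4)
    (hrad : Real.sqrt N * (Real.pi / 2 * (((P.d - 1 : ℕ) : ℝ) * n * a)) ≤ S) (Λ : Finset (PBond P j))
    (hΛ : ∀ b ∈ Λ, b ∈ boxBonds lo hi) :
    windowSU Λ (1 : GaugeField P j (SUN N)) S (fun b : ↥Λ => U b) = 1 :=
  windowSU_eq_one_of_mem Λ 1 S fun b => mem_expWindowSU_of_comb U hS₀ hUa ha hn hU hN4 hrad (hΛ b b.2)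

variable [DecidableEq (PBond P j)]

/-- **(LR)₀ FOR THE TREE-GAUGE SUBSTITUTION, `G = SU(N)`**: if the box plaquettes of `U[comb := 1]` are `a`-small, then
`windowSU Λ 1 S (U[comb := 1]|_Λ) = 1` for every `Λ ⊆ boxBonds lo hi` (`0 ≤ a`, `hi ≤ lo + n`, `N·(d−1)·n·a < 4`,
`√N·(π/2)·(d−1)·n·a ≤ S`) — the bond window of `ShellMeasureWilsonRealizedSUN.slotAntiConcentration_wilson_suN` is
IMPLIED by plaquette smallness after the tree gauge (the `SU(N)` form of
`ShellMeasureAxialReach.expWindowDensity_fixTo_comb_eq_one`). [folklore] -/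
theorem windowSU_fixTo_comb_eq_one (U : GaugeField P j (SUN N)) {lo hi : Fin P.d → ℤ} {a S : ℝ}
    {S₀ : Set (Plaq P j)} {n : ℕ} (hS₀ : boxPlaqs lo hi ⊆ S₀)
    (hUa : PlaqSmallOn S₀ a (fixTo (combBonds lo hi) 1 U)) (ha : 0 ≤ a)
    (hn : ∀ κ, hi κ ≤ lo κ + n) (hN4 : (N : ℝ) * (((P.d - 1 : ℕ) : ℝ) * n * a) < 4)
    (hrad : Real.sqrt N * (Real.pi / 2 * (((P.d - 1 : ℕ) : ℝ) * n * a)) ≤ S) (Λ : Finset (PBond P j))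
    (hΛ : ∀ b ∈ Λ, b ∈ boxBonds lo hi) :
    windowSU Λ (1 : GaugeField P j (SUN N)) S
      (fun b : ↥Λ => fixTo (combBonds lo hi) 1 U b) = 1 :=
  windowSU_eq_one_of_comb _ hS₀ hUa ha hn (ShellMeasureAxialReach.fixTo_comb_eq_one lo hi U) hN4 hrad Λ hΛ

end Summit.QuantumFields.BalabanUV.T4Continuum.ShellMeasureAxialReachSUN

end
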